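import Summits.HubbardSuperconductivity.HubbardSuperconductivity.Theorems.AnisotropyChordTransferFibre3N1RowCellSound

/-!
# Route `AnisotropyChord` / H0 rotor rung, LEVEL 2 row `N₁`: the `ν`-column `[26471, 27000]/10⁶` — named-sum brackets

The `ν`-cell `ν = λ₂/θ² ∈ [0.026471, 0.027]` of the ∀L ≥ 128 kernel certificate of the (KT-1″) trial-gap bound: the twelve
L-uniform named-sum brackets (`colN26471` : `L2.NamedCell`, `T = 241/10⁵ ≥ θ₀²`, rounding denominator `10⁶`) and their kernel
certificate ★ `colN26471_check : colN26471.check = true` (integer B1 evaluator of p2 g4, one `decide`, ≈ 2 min); shared by all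
`a`-cells of this column (files `…N1RowL2N26471A….lean`).  Generated by p2 g5's cells/mkfiles.py (HOME/hubbard-h0-rotor-p2/cells/).
Prover seat `hubbard-h0-rotor-p2` g5; helper for piece A = stmt-HubbardSuperconductivity-23918 of rung 19089
(`--supports`, helper class).  Nothing here proves superconductivity in the Hubbard model; one kernel-certified piece of ONE
conditional reduction (the GM₃ ∀L certificate, Level-2 row `N₁`); the rotor TARGET as originally worded stays FALSE (g15 verdict).
Mathlib + the tree only; no sorry.
-/

set_option linter.dupNamespace false
set_option autoImplicit false

open Literature.Analysis.ValidatedNumerics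

namespace Summit.HubbardSuperconductivity.HubbardSuperconductivity.Theorems.AnisotropyChord.Transfer.Fibre3.L2.N1

/-- the column data: `ν`-cell `[26471, 27000]/10⁶` and the twelve certified brackets of
`θ⁴S₂, θ⁶S₃, θ⁸S₄, θ⁴T10, θ⁴T11, θ⁶G21, θ⁶G12, θ⁸G22, θ⁸G31, θ⁸G13, θ⁴Tx(1,0), θ⁴Tx(1,1)`. -/
def colN26471 : L2.NamedCell :=
  { n1 := 26471,
    n2 := 27000,
    νd := 1000000,
    Tn := 241,
    Td := 100000,
    D := 1000000,
    bS2 := (784783/125000, 6314647393/1000000000),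
    bS3 := (1254191/250000, 2516029163/500000000),
    bS4 := (47489/10000, 148972003/31250000),
    bT10 := (238579/62500, 3852555189/1000000000),
    bT11 := (1064119/250000, 4292983189/1000000000),
    bG21 := (2178337/1000000, 2187043573/1000000000),
    bG12 := (2178337/1000000, 2187043573/1000000000),
    bG22 := (638203/500000, 1283860141/1000000000),
    bG31 := (867273/500000, 1743424141/1000000000),
    bG13 := (867273/500000, 1743424141/1000000000),
    bTx10 := (3782550811/1000000000, 3852555189/1000000000),
    bTx11 := (4222010811/1000000000, 4292983189/1000000000) }

/-- ★ the named-sum brackets of the column hold (kernel evaluation of the integer B1 certificate). -/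
theorem colN26471_check : colN26471.check = true := by decide +kernel

end Summit.HubbardSuperconductivity.HubbardSuperconductivity.Theorems.AnisotropyChord.Transfer.Fibre3.L2.N1
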